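import Summits.QuantumFields.YangMills.Theorems.LuscherReductionOneSiteLevelsGnDiagPointwise

/-!
# The diagonal pair term, II: shear integrals and the integrated lower bound
# (support module for the registered stub `stub_absLower` of crux `OneSiteLevels`, route `LuscherReduction`,
# item stmt-QuantumFields-20007; fleet seat prover ym-luscher-20007-p2)

Continuation of `…GnDiagPointwise`: the shear formula `∫ h(y)k(y'−y) d(y,y') = (∫h)(∫k)` on `ZM × ZM` (Lebesgue measure is
invariant under `(y,y') ↦ (y, y'−y)`), and the integrated lower bound for the diagonal pair term of `⟨Ψ_G, K_B Ψ_G⟩`: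

`T_{σσ} ≥ e^{6B} [ √(π/B')⁹ (∫Φ² − (4B')⁻¹∫‖∇Φ‖²) − μ²(8/(3e))(3 I₀ ∫‖y‖²Φ² + 2 I₂ ∫Φ²) ]`   (`gnPairTerm_diag_ge`),

`Φ = gnPhi B μ G`, `B' = Bμ²`, `I₀ = ∫e^{−B'‖s‖²/2}`, `I₂ = ∫‖s‖²e^{−B'‖s‖²/2}` — the flat Gaussian form bound `gaussForm_ge`
for the main part and the pointwise bound `abs_diag_error_le` for the curvature error.

## WHAT THIS IS NOT
Analysis of one integral; NOT the stub, NOT THE CLAY GAP.  Sorry-free, no named fact.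
-/

set_option autoImplicit false

noncomputable section

open MeasureTheory Filter Topology Real
open scoped Matrix ENNReal
open Literature.MathematicalPhysics.QuantumFieldTheory
open Literature.MathematicalPhysics.QuantumLattice
open Literature.Analysis.OperatorTheory.YMMatrixModel

namespace Summit.QuantumFields.YangMills.Theorems.FemtoTransferGap

/-! ### §3. Shear integrals `∫ h(y) k(y' − y) d(y,y') = (∫h)(∫k)` -/

section Shear

/-- **Shear formula**: for integrable `h, k` on `ZM`, `(y,y') ↦ h(y) k(y' − y)` is integrable on `ZM × ZM` and
`∫ h(y) k(y'−y) d(y,y') = (∫ h)(∫ k)` (the shear `(y,y') ↦ (y, y'−y)` preserves Lebesgue measure). [folklore] -/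
theorem integrable_and_integral_shear {h k : ZM → ℝ} (hh : Integrable h) (hk : Integrable k) :
    Integrable (fun q : ZM × ZM => h q.1 * k (q.2 - q.1)) ((volume : Measure ZM).prod volume) ∧
      ∫ q : ZM × ZM, h q.1 * k (q.2 - q.1) ∂((volume : Measure ZM).prod volume) = (∫ y, h y) * ∫ s, k s := by
  have hT := measurePreserving_prod_sub (volume : Measure ZM) (volume : Measure ZM)
  set F : ZM × ZM → ℝ := fun z => h z.1 * k z.2 with hF
  have hFi : Integrable F ((volume : Measure ZM).prod volume) := hh.mul_prod hk
  have hcomp : (fun q : ZM × ZM => h q.1 * k (q.2 - q.1)) = F ∘ fun z : ZM × ZM => (z.1, z.2 - z.1) := by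
    funext q; simp [hF]
  have hFT : AEStronglyMeasurable F (Measure.map (fun z : ZM × ZM => (z.1, z.2 - z.1)) ((volume : Measure ZM).prod volume)) := by
    rw [hT.map_eq]; exact hFi.aestronglyMeasurable
  refine ⟨?_, ?_⟩
  · rw [hcomp]; exact (hT.integrable_comp hFi.aestronglyMeasurable).2 hFi
  · rw [hcomp]
    calc ∫ q, (F ∘ fun z : ZM × ZM => (z.1, z.2 - z.1)) q ∂((volume : Measure ZM).prod volume)
        = ∫ q, F q ∂(Measure.map (fun z : ZM × ZM => (z.1, z.2 - z.1)) ((volume : Measure ZM).prod volume)) :=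
          (integral_map hT.measurable.aemeasurable hFT).symm
      _ = ∫ q, F q ∂((volume : Measure ZM).prod volume) := by rw [hT.map_eq]
      _ = (∫ y, h y) * ∫ s, k s := integral_prod_mul h k

/-- The swapped shear formula: `∫ h(y') k(y − y') d(y,y') = (∫ h)(∫ k)`, with integrability. [folklore] -/
theorem integrable_and_integral_shear_swap {h k : ZM → ℝ} (hh : Integrable h) (hk : Integrable k) :
    Integrable (fun q : ZM × ZM => h q.2 * k (q.1 - q.2)) ((volume : Measure ZM).prod volume) ∧
      ∫ q : ZM × ZM, h q.2 * k (q.1 - q.2) ∂((volume : Measure ZM).prod volume) = (∫ y, h y) * ∫ s, k s := by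
  obtain ⟨hi, hv⟩ := integrable_and_integral_shear hh hk
  refine ⟨?_, ?_⟩
  · exact hi.swap
  · calc ∫ q : ZM × ZM, h q.2 * k (q.1 - q.2) ∂((volume : Measure ZM).prod volume)
        = ∫ q : ZM × ZM, (fun z : ZM × ZM => h z.1 * k (z.2 - z.1)) q.swap ∂((volume : Measure ZM).prod volume) := rfl
      _ = ∫ q : ZM × ZM, h q.1 * k (q.2 - q.1) ∂((volume : Measure ZM).prod volume) :=
          integral_prod_swap (fun z : ZM × ZM => h z.1 * k (z.2 - z.1))
      _ = (∫ y, h y) * ∫ s, k s := hv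

end Shear

/-! ### §4. The diagonal pair term: Gaussian main part minus the curvature error -/

section DiagBound

variable {B μ : ℝ} {G : ZM → ℝ}

/-- `Φ` is `C¹` when `G` is. [folklore] -/
theorem contDiff_gnPhi (B μ : ℝ) (hG : ContDiff ℝ 1 G) : ContDiff ℝ 1 (gnPhi B μ G) :=
  contDiff_const.mul (hG.mul (contDiff_gnH B μ))

/-- `Φ` has compact support when `G` has. [folklore] -/
theorem hasCompactSupport_gnPhi (B μ : ℝ) (hGs : HasCompactSupport G) : HasCompactSupport (gnPhi B μ G) := by
  unfold gnPhi
  exact (hGs.mul_right (f' := gnH B μ)).mul_left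

/-- The Gaussian kernel `k₀(s) = e^{−Bμ²‖s‖²/2}`. [folklore] -/
def diagKer0 (B μ : ℝ) (s : ZM) : ℝ := Real.exp (-(B * μ ^ 2 * ‖s‖ ^ 2) / 2)

/-- The second-moment kernel `k₂(s) = ‖s‖² e^{−Bμ²‖s‖²/2}`. [folklore] -/
def diagKer2 (B μ : ℝ) (s : ZM) : ℝ := ‖s‖ ^ 2 * Real.exp (-(B * μ ^ 2 * ‖s‖ ^ 2) / 2)

/-- The main (flat Gaussian) integrand `Φ(y) e^{−Bμ²‖y−y'‖²} Φ(y')`. [folklore] -/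
def diagMain (B μ : ℝ) (G : ZM → ℝ) (q : ZM × ZM) : ℝ :=
  gnPhi B μ G q.1 * Real.exp (-(B * μ ^ 2 * ‖q.1 - q.2‖ ^ 2)) * gnPhi B μ G q.2

/-- The dominating function of the curvature error (symmetrised form of `abs_diag_error_le`). [folklore] -/
def diagDom (B μ : ℝ) (G : ZM → ℝ) (q : ZM × ZM) : ℝ :=
  μ ^ 2 * (8 / (3 * Real.exp 1)) * (1 / 2 : ℝ) *
    (3 * ((‖q.1‖ ^ 2 * gnPhi B μ G q.1 ^ 2) * diagKer0 B μ (q.2 - q.1)) + 2 * (gnPhi B μ G q.1 ^ 2 * diagKer2 B μ (q.2 - q.1))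
      + 3 * ((‖q.2‖ ^ 2 * gnPhi B μ G q.2 ^ 2) * diagKer0 B μ (q.1 - q.2)) + 2 * (gnPhi B μ G q.2 ^ 2 * diagKer2 B μ (q.1 - q.2)))

/-- `diagDom` equals the right-hand side of `abs_diag_error_le`. [folklore] -/
theorem diagDom_eq (B μ : ℝ) (G : ZM → ℝ) (q : ZM × ZM) :
    diagDom B μ G q = μ ^ 2 * (8 / (3 * Real.exp 1)) * ((1 / 2 : ℝ) *
      ((3 * ‖q.1‖ ^ 2 + 2 * ‖q.1 - q.2‖ ^ 2) * gnPhi B μ G q.1 ^ 2 + (3 * ‖q.2‖ ^ 2 + 2 * ‖q.1 - q.2‖ ^ 2) * gnPhi B μ G q.2 ^ 2)) *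
      Real.exp (-(B * μ ^ 2 * ‖q.1 - q.2‖ ^ 2) / 2) := by
  unfold diagDom diagKer0 diagKer2
  rw [norm_sub_rev q.2 q.1]
  ring

/-- The full diagonal integrand in terms of `diagMain` and the error factor. [folklore] -/
theorem diag_integrand_eq (B μ : ℝ) (G : ZM → ℝ) (σ : Fin 3 → Bool) (q : ZM × ZM) :
    (gnDensityReal μ q.1 * gnDensityReal μ q.2) * (G q.1 * transferKernel su2Rep B (gnChart μ σ q.1) (gnChart μ σ q.2) * G q.2) =
      Real.exp (6 * B) * (diagMain B μ G q + gnPhi B μ G q.1 * gnPhi B μ G q.2 * Real.exp (-(B * μ ^ 2 * ‖q.1 - q.2‖ ^ 2)) *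
        (Real.exp (B * ∑ i : Fin 3, gnDefect (fun a => μ * q.1 (i, a)) (fun a => μ * q.2 (i, a))) - 1)) := by
  rw [gnPairTerm_diag_integrand, diagMain]; ring

/-- Integrability of the Gaussian kernels. [folklore] -/
theorem integrable_diagKer (hB : 0 < B) (hμ : 0 < μ) : Integrable (diagKer0 B μ) ∧ Integrable (diagKer2 B μ) := by
  have hb : 0 < B * μ ^ 2 / 2 := by positivity
  have e : ∀ s : ZM, Real.exp (-(B * μ ^ 2 * ‖s‖ ^ 2) / 2) = Real.exp (-(B * μ ^ 2 / 2) * ‖s‖ ^ 2) := fun s => by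
    congr 1; ring
  have e0 : diagKer0 B μ = fun s => Real.exp (-(B * μ ^ 2 / 2) * ‖s‖ ^ 2) := funext fun s => by rw [diagKer0, e s]
  have e2 : diagKer2 B μ = fun s => ‖s‖ ^ 2 * Real.exp (-(B * μ ^ 2 / 2) * ‖s‖ ^ 2) := funext fun s => by rw [diagKer2, e s]
  rw [e0, e2]
  exact ⟨GaussForm.integrable_gauss hb, GaussForm.integrable_normSq_mul_gauss hb⟩

/-- **The diagonal pair term, lower bound.**  Let `B, μ > 0`, `G ∈ C¹_c` vanishing outside `‖y‖ ≤ r` with `μ²r² ≤ 1/16`, `Φ = gnPhi B μ G`,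
`B' = Bμ²`.  Then
`T_{σσ} ≥ e^{6B} [ √(π/B')⁹ (∫Φ² − (4B')⁻¹ ∫‖∇Φ‖²) − μ²(8/(3e))(3 I₀ ∫‖y‖²Φ² + 2 I₂ ∫Φ²) ]`
with `I₀ = ∫ e^{−B'‖s‖²/2} ds`, `I₂ = ∫ ‖s‖² e^{−B'‖s‖²/2} ds`. [folklore] -/
theorem gnPairTerm_diag_ge (hB : 0 < B) (hμ : 0 < μ) (hG : ContDiff ℝ 1 G) (hGs : HasCompactSupport G)
    {r : ℝ} (hsupp : ∀ y, G y ≠ 0 → ‖y‖ ≤ r) (hr : μ ^ 2 * r ^ 2 ≤ 1 / 16) (σ : Fin 3 → Bool) :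
    Real.exp (6 * B) * (Real.sqrt (π / (B * μ ^ 2)) ^ Fintype.card (Fin 3 × Fin 3) *
        ((∫ y, gnPhi B μ G y ^ 2) - (1 / (4 * (B * μ ^ 2))) * ∫ y, ‖gradient (gnPhi B μ G) y‖ ^ 2)
      - μ ^ 2 * (8 / (3 * Real.exp 1)) *
        (3 * (∫ s : ZM, diagKer0 B μ s) * (∫ y, ‖y‖ ^ 2 * gnPhi B μ G y ^ 2)
          + 2 * (∫ s : ZM, diagKer2 B μ s) * ∫ y, gnPhi B μ G y ^ 2)) ≤
      gnPairTerm B μ G (σ, σ) := by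
  have hB'0 : 0 < B * μ ^ 2 := by positivity
  have hΦ1 : ContDiff ℝ 1 (gnPhi B μ G) := contDiff_gnPhi B μ hG
  have hΦc : Continuous (gnPhi B μ G) := hΦ1.continuous
  have hΦs : HasCompactSupport (gnPhi B μ G) := hasCompactSupport_gnPhi B μ hGs
  have hΦi : Integrable (gnPhi B μ G) := hΦc.integrable_of_hasCompactSupport hΦs
  have hΦ2i : Integrable fun y => gnPhi B μ G y ^ 2 := (hΦc.pow 2).integrable_of_hasCompactSupport (GaussForm.hasCompactSupport_sq hΦs)
  have hyΦ2i : Integrable fun y => ‖y‖ ^ 2 * gnPhi B μ G y ^ 2 :=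
    ((continuous_norm.pow 2).mul (hΦc.pow 2)).integrable_of_hasCompactSupport (GaussForm.hasCompactSupport_sq hΦs).mul_left
  obtain ⟨hk₀i, hk₂i⟩ := integrable_diagKer hB hμ
  -- the four shear integrals making up `∫ diagDom`
  obtain ⟨hA1, vA1⟩ := integrable_and_integral_shear (h := fun y => ‖y‖ ^ 2 * gnPhi B μ G y ^ 2) (k := diagKer0 B μ) hyΦ2i hk₀i
  obtain ⟨hA2, vA2⟩ := integrable_and_integral_shear (h := fun y => gnPhi B μ G y ^ 2) (k := diagKer2 B μ) hΦ2i hk₂i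
  obtain ⟨hA3, vA3⟩ := integrable_and_integral_shear_swap (h := fun y => ‖y‖ ^ 2 * gnPhi B μ G y ^ 2) (k := diagKer0 B μ) hyΦ2i hk₀i
  obtain ⟨hA4, vA4⟩ := integrable_and_integral_shear_swap (h := fun y => gnPhi B μ G y ^ 2) (k := diagKer2 B μ) hΦ2i hk₂i
  have i1 : Integrable (fun q : ZM × ZM => 3 * ((‖q.1‖ ^ 2 * gnPhi B μ G q.1 ^ 2) * diagKer0 B μ (q.2 - q.1)))
      ((volume : Measure ZM).prod volume) := hA1.const_mul 3
  have i2 : Integrable (fun q : ZM × ZM => 2 * (gnPhi B μ G q.1 ^ 2 * diagKer2 B μ (q.2 - q.1)))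
      ((volume : Measure ZM).prod volume) := hA2.const_mul 2
  have i3 : Integrable (fun q : ZM × ZM => 3 * ((‖q.2‖ ^ 2 * gnPhi B μ G q.2 ^ 2) * diagKer0 B μ (q.1 - q.2)))
      ((volume : Measure ZM).prod volume) := hA3.const_mul 3
  have i4 : Integrable (fun q : ZM × ZM => 2 * (gnPhi B μ G q.2 ^ 2 * diagKer2 B μ (q.1 - q.2)))
      ((volume : Measure ZM).prod volume) := hA4.const_mul 2
  have i12 : Integrable (fun q : ZM × ZM => 3 * ((‖q.1‖ ^ 2 * gnPhi B μ G q.1 ^ 2) * diagKer0 B μ (q.2 - q.1))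
      + 2 * (gnPhi B μ G q.1 ^ 2 * diagKer2 B μ (q.2 - q.1))) ((volume : Measure ZM).prod volume) := i1.add i2
  have i123 : Integrable (fun q : ZM × ZM => 3 * ((‖q.1‖ ^ 2 * gnPhi B μ G q.1 ^ 2) * diagKer0 B μ (q.2 - q.1))
      + 2 * (gnPhi B μ G q.1 ^ 2 * diagKer2 B μ (q.2 - q.1))
      + 3 * ((‖q.2‖ ^ 2 * gnPhi B μ G q.2 ^ 2) * diagKer0 B μ (q.1 - q.2))) ((volume : Measure ZM).prod volume) := i12.add i3
  have i1234 : Integrable (fun q : ZM × ZM => 3 * ((‖q.1‖ ^ 2 * gnPhi B μ G q.1 ^ 2) * diagKer0 B μ (q.2 - q.1))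
      + 2 * (gnPhi B μ G q.1 ^ 2 * diagKer2 B μ (q.2 - q.1))
      + 3 * ((‖q.2‖ ^ 2 * gnPhi B μ G q.2 ^ 2) * diagKer0 B μ (q.1 - q.2))
      + 2 * (gnPhi B μ G q.2 ^ 2 * diagKer2 B μ (q.1 - q.2))) ((volume : Measure ZM).prod volume) := i123.add i4
  have hDomi : Integrable (diagDom B μ G) ((volume : Measure ZM).prod volume) := by
    have e : diagDom B μ G = fun q => μ ^ 2 * (8 / (3 * Real.exp 1)) * (1 / 2 : ℝ) *
        (3 * ((‖q.1‖ ^ 2 * gnPhi B μ G q.1 ^ 2) * diagKer0 B μ (q.2 - q.1)) + 2 * (gnPhi B μ G q.1 ^ 2 * diagKer2 B μ (q.2 - q.1))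
          + 3 * ((‖q.2‖ ^ 2 * gnPhi B μ G q.2 ^ 2) * diagKer0 B μ (q.1 - q.2)) + 2 * (gnPhi B μ G q.2 ^ 2 * diagKer2 B μ (q.1 - q.2))) :=
      funext fun q => rfl
    rw [e]; exact i1234.const_mul _
  have hDom_val : ∫ q, diagDom B μ G q ∂((volume : Measure ZM).prod volume) = μ ^ 2 * (8 / (3 * Real.exp 1)) *
      (3 * (∫ s, diagKer0 B μ s) * (∫ y, ‖y‖ ^ 2 * gnPhi B μ G y ^ 2) + 2 * (∫ s, diagKer2 B μ s) * ∫ y, gnPhi B μ G y ^ 2) := by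
    unfold diagDom
    rw [integral_const_mul, integral_add i123 i4, integral_add i12 i3, integral_add i1 i2, integral_const_mul, integral_const_mul,
      integral_const_mul, integral_const_mul, vA1, vA2, vA3, vA4]
    ring
  -- the main Gaussian integrand
  have hMfi : Integrable (diagMain B μ G) ((volume : Measure ZM).prod volume) := by
    refine ((hΦi.norm).mul_prod (hΦi.norm)).mono' ?_ (ae_of_all _ fun q => ?_)
    · exact (((hΦc.comp continuous_fst).mul (by fun_prop : Continuous fun q : ZM × ZM =>
        Real.exp (-(B * μ ^ 2 * ‖q.1 - q.2‖ ^ 2)))).mul (hΦc.comp continuous_snd)).aestronglyMeasurable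
    · rw [diagMain, Real.norm_eq_abs, abs_mul, abs_mul, Real.norm_eq_abs, Real.norm_eq_abs]
      have h1 : |Real.exp (-(B * μ ^ 2 * ‖q.1 - q.2‖ ^ 2))| ≤ 1 := by
        rw [abs_of_nonneg (Real.exp_pos _).le, Real.exp_le_one_iff]
        have := sq_nonneg ‖q.1 - q.2‖
        have : 0 ≤ B * μ ^ 2 * ‖q.1 - q.2‖ ^ 2 := by positivity
        linarith
      calc |gnPhi B μ G q.1| * |Real.exp (-(B * μ ^ 2 * ‖q.1 - q.2‖ ^ 2))| * |gnPhi B μ G q.2|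
          ≤ |gnPhi B μ G q.1| * 1 * |gnPhi B μ G q.2| := by gcongr
        _ = |gnPhi B μ G q.1| * |gnPhi B μ G q.2| := by ring
  have hMval : ∫ q, diagMain B μ G q ∂((volume : Measure ZM).prod volume) =
      ∫ y, ∫ y', gnPhi B μ G y * Real.exp (-(B * μ ^ 2 * ‖y - y'‖ ^ 2)) * gnPhi B μ G y' := by
    rw [integral_prod _ hMfi]; rfl
  have hGauss := GaussForm.gaussForm_ge (ι := Fin 3 × Fin 3) hB'0 hΦ1 hΦs
  have eB : ∀ y y' : ZM, Real.exp (-(B * μ ^ 2) * ‖y - y'‖ ^ 2) = Real.exp (-(B * μ ^ 2 * ‖y - y'‖ ^ 2)) := fun y y' => by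
    rw [neg_mul]
  simp_rw [eB] at hGauss
  -- the diagonal term as an integral, and its integrand dominates `e^{6B}(diagMain − diagDom)`
  have hT : gnPairTerm B μ G (σ, σ) = ∫ q, Real.exp (6 * B) * (diagMain B μ G q + gnPhi B μ G q.1 * gnPhi B μ G q.2 *
      Real.exp (-(B * μ ^ 2 * ‖q.1 - q.2‖ ^ 2)) *
        (Real.exp (B * ∑ i : Fin 3, gnDefect (fun a => μ * q.1 (i, a)) (fun a => μ * q.2 (i, a))) - 1)) ∂((volume : Measure ZM).prod volume) := by
    unfold gnPairTerm
    exact integral_congr_ae (ae_of_all _ fun q => diag_integrand_eq B μ G σ q)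
  have herr : ∀ q : ZM × ZM, |gnPhi B μ G q.1 * gnPhi B μ G q.2 * Real.exp (-(B * μ ^ 2 * ‖q.1 - q.2‖ ^ 2)) *
      (Real.exp (B * ∑ i : Fin 3, gnDefect (fun a => μ * q.1 (i, a)) (fun a => μ * q.2 (i, a))) - 1)| ≤ diagDom B μ G q := by
    intro q; rw [diagDom_eq]; exact abs_diag_error_le hB hμ hsupp hr q.1 q.2
  have h6 : 0 ≤ Real.exp (6 * B) := (Real.exp_pos _).le
  have hptw : ∀ q : ZM × ZM, Real.exp (6 * B) * (diagMain B μ G q - diagDom B μ G q) ≤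
      Real.exp (6 * B) * (diagMain B μ G q + gnPhi B μ G q.1 * gnPhi B μ G q.2 * Real.exp (-(B * μ ^ 2 * ‖q.1 - q.2‖ ^ 2)) *
        (Real.exp (B * ∑ i : Fin 3, gnDefect (fun a => μ * q.1 (i, a)) (fun a => μ * q.2 (i, a))) - 1)) := by
    intro q
    refine mul_le_mul_of_nonneg_left ?_ h6
    have := neg_le_of_abs_le (herr q)
    linarith
  have hTi : Integrable (fun q : ZM × ZM => Real.exp (6 * B) * (diagMain B μ G q + gnPhi B μ G q.1 * gnPhi B μ G q.2 *
      Real.exp (-(B * μ ^ 2 * ‖q.1 - q.2‖ ^ 2)) *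
        (Real.exp (B * ∑ i : Fin 3, gnDefect (fun a => μ * q.1 (i, a)) (fun a => μ * q.2 (i, a))) - 1))) ((volume : Measure ZM).prod volume) := by
    have hGm : Measurable G := hG.continuous.measurable
    have hmeas : AEStronglyMeasurable (fun q : ZM × ZM => (gnDensityReal μ q.1 * gnDensityReal μ q.2) *
        (G q.1 * transferKernel su2Rep B (gnChart μ σ q.1) (gnChart μ σ q.2) * G q.2)) ((volume : Measure ZM).prod volume) := by
      refine Measurable.aestronglyMeasurable ?_
      refine (((measurable_gnDensityReal μ).comp measurable_fst).mul ((measurable_gnDensityReal μ).comp measurable_snd)).mul ?_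
      exact ((hGm.comp measurable_fst).mul ((measurable_transferKernel_su2 B).comp (measurable_gnPairChart μ (σ, σ)))).mul
        (hGm.comp measurable_snd)
    have e : (fun q : ZM × ZM => (gnDensityReal μ q.1 * gnDensityReal μ q.2) *
        (G q.1 * transferKernel su2Rep B (gnChart μ σ q.1) (gnChart μ σ q.2) * G q.2)) =
        fun q => Real.exp (6 * B) * (diagMain B μ G q + gnPhi B μ G q.1 * gnPhi B μ G q.2 *
          Real.exp (-(B * μ ^ 2 * ‖q.1 - q.2‖ ^ 2)) *
          (Real.exp (B * ∑ i : Fin 3, gnDefect (fun a => μ * q.1 (i, a)) (fun a => μ * q.2 (i, a))) - 1)) :=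
      funext fun q => diag_integrand_eq B μ G σ q
    rw [e] at hmeas
    refine (((hMfi.norm.add hDomi).const_mul (Real.exp (6 * B)))).mono' hmeas (ae_of_all _ fun q => ?_)
    rw [Real.norm_eq_abs, abs_mul, abs_of_nonneg h6]
    refine mul_le_mul_of_nonneg_left ?_ h6
    simp only [Pi.add_apply, Real.norm_eq_abs]
    exact (abs_add_le _ _).trans (by linarith [herr q])
  -- conclude
  have hmain : ∫ q, Real.exp (6 * B) * (diagMain B μ G q - diagDom B μ G q) ∂((volume : Measure ZM).prod volume) ≤
      gnPairTerm B μ G (σ, σ) := by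
    rw [hT]; exact integral_mono ((hMfi.sub hDomi).const_mul _) hTi hptw
  rw [integral_const_mul, integral_sub hMfi hDomi, hMval, hDom_val] at hmain
  have hfinal : Real.sqrt (π / (B * μ ^ 2)) ^ Fintype.card (Fin 3 × Fin 3) *
      ((∫ y, gnPhi B μ G y ^ 2) - (1 / (4 * (B * μ ^ 2))) * ∫ y, ‖gradient (gnPhi B μ G) y‖ ^ 2) ≤
      ∫ y, ∫ y', gnPhi B μ G y * Real.exp (-(B * μ ^ 2 * ‖y - y'‖ ^ 2)) * gnPhi B μ G y' := hGauss
  nlinarith [mul_le_mul_of_nonneg_left hfinal h6, hmain]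

end DiagBound

end Summit.QuantumFields.YangMills.Theorems.FemtoTransferGap

end
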